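import Summits.ResolutionOfSingularities.ResolutionOfSingularities.Theorems.MarkedTransferCampaignW46ThreefoldsGammaFreeGlobalCurves
import HarnessLib

/-!
# [OURS · L1 W4.6 rung (ii) ladder support] THE IDENTITY STEP ALONG A REGULAR CARTIER CENTRE — dimension-free form of the
# `d = 1` mechanism of `…GammaFreeGlobalCurves.lean` (brick for the `d = 2` rung, RUNG MAP (ii-2) «regular curve components of
# {ord ≥ m}, which are Cartier ⇒ identity steps dividing by 𝓘_C^m»)

Cell res-hironaka, LADDER-RESOLUTION rung L (D-0089), slot W4.6, rung (ii) dimension ladder (res-L1-type-o1 p496755); seat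
res-L1-s46-pv-10 = res-D-pv-047 (unit object `gammaFreeGlobalDimLE_one` closed, p497830), filed as SUPPORT for the `d = 2` rung
(unit res-L1-s46-pv-11) on the holder's word. Host route MarkedTransfer, host item `HypersurfaceOrderReductionDimLeThree`
(stmt-ResolutionOfSingularities-16156), `--kind proof --supports … --as helper`. Everything is OURS; nothing is a statement of
the manuscript; no typed `Hironaka2017` candidate and no `Literature.…` named FACT enters. AI-written; weaker than expert review.

## What is proved (any scheme `X`; no integrality, no Noetherian hypothesis, no dimension bound)

* `CampaignW46.stalkIdeal_vanishingIdeal_of_not_mem` — off a closed subset `D`, the ideal sheaf `𝓘_D` has unit stalks.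
* `CampaignW46.step_of_cartierCentre` — for a closed `D ⊆ X` whose ideal `𝓘_D` is an EFFECTIVE CARTIER divisor with REGULAR
  subscheme and which lies in the locus `{y | ord_y I ≥ m}`: the identity `𝟙 X`, read as the blowing up of `X` along `𝓘_D`
  (`IsBlowup.id`, Görtz–Wedhorn remark after Def. 13.90), is a sequence of permissible blowing-ups of length one for `(I, m)`
  (`IsPermissibleBlowupSeq.single`) with last transform `J₁ := (I : 𝓘_D^m)` (the controlled transform `controlledTransform (𝟙 X)
  𝓘_D I m`); its stalks are the colon ideals `J₁,y = (I_y : 𝓘_{D,y}^m)` (`IsBlowup.stalkIdeal_controlledTransform`, Atiyah–Macdonald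
  Cor. 3.15), equal to `I_y` off `D`, and `I ⊆ J₁`.
* `CampaignW46.orderReducible_of_cartierCentre_step` — hence `OrderReducible J₁ m → OrderReducible I m` (the ladder's induction
  step `OrderReducible.of_blowup` for such centres, with `X′ = X`).

The order law ON the centre (`ord_y J₁ = ord_y I − m` for `y ∈ D` on a regular `X`) is NOT in this file (it needs the
prime-divisibility descent from the generic points of `D`; filed separately on the `d = 2` holder's word).

References: `…GammaFreeGlobalCurves.lean` (p497830: the `D = {x}` case, `colon_top_set`), `…GammaFreeGlobalLadder.lean` (p496755),
`…GammaFreeGlobal.lean` (p493059); tree `Resolution/Blowups.lean` (`IsBlowup.id`), `Resolution/ColonIdealSheafFG.lean`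
(`IsBlowup.stalkIdeal_controlledTransform`). H. Hironaka, ms. 2017-03-23, §2.1 p.4, Def. 2.1 p.5 — scope only, under adjudication,
not cited as fact. [Hironaka2017]
-/

noncomputable section

set_option linter.dupNamespace false -- mandated namespace of this single-conjunct summit

open CategoryTheory AlgebraicGeometry TopologicalSpace IsLocalRing

namespace Summit.ResolutionOfSingularities.ResolutionOfSingularities.Theorems

namespace CampaignW46

open Literature.AlgebraicGeometry.Resolution
open Scheme.IdealSheafData

universe u

variable {X : Scheme.{u}}

/-- Off the closed subset `D`, the ideal sheaf `𝓘_D` of the reduced subscheme `D` has unit stalks (`y ∉ D = supp 𝓘_D`).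
[folklore] -/
theorem stalkIdeal_vanishingIdeal_of_not_mem (D : Closeds X) {y : X} (hy : y ∉ (D : Set X)) :
    stalkIdeal (vanishingIdeal D) y = ⊤ := by
  by_contra hne
  have hle : stalkIdeal (vanishingIdeal D) y ≤ maximalIdeal _ := IsLocalRing.le_maximalIdeal hne
  have hy' : y ∈ ((vanishingIdeal D).support : Set X) := (mem_support_iff_stalkIdeal_le _ y).mpr hle
  rw [coe_support_vanishingIdeal] at hy'
  exact hy hy'

/-- **THE IDENTITY STEP ALONG A REGULAR CARTIER CENTRE** (dimension-free). Let `D ⊆ X` be closed with `𝓘_D` an effective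
Cartier divisor, `V(𝓘_D)` regular, and `D ⊆ {y | m ≤ ord_y I}`. Then `𝟙 X` is the blowing up of `X` along `𝓘_D` (`IsBlowup.id`)
and, with `J₁ := controlledTransform (𝟙 X) 𝓘_D I m = (I : 𝓘_D^m)`: (1) `𝟙 X, J₁` is a sequence of permissible blowing-ups of
length one for `(I, m)`; (2) `J₁,y = (I_y : 𝓘_{D,y}^m)` at every `y`; (3) `J₁,y = I_y` off `D`; (4) `I ⊆ J₁`. (The `D = {x}`,
DVR-stalk case is `step_at_point` of `…GammaFreeGlobalCurves.lean`.) [folklore] -/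
theorem step_of_cartierCentre (D : Closeds X) (hreg : Scheme.IsRegular (vanishingIdeal D).subscheme)
    (hcart : IsEffectiveCartier (vanishingIdeal D)) {I : X.IdealSheafData} {m : ℕ}
    (hD : ∀ y ∈ (D : Set X), (m : ℕ∞) ≤ idealOrder I y) :
    IsPermissibleBlowupSeq I m (𝟙 X) (controlledTransform (𝟙 X) (vanishingIdeal D) I m) ∧
      (∀ y : X, stalkIdeal (controlledTransform (𝟙 X) (vanishingIdeal D) I m) y =
        Submodule.colon (stalkIdeal I y) ((stalkIdeal (vanishingIdeal D) y ^ m : Ideal _) : Set _)) ∧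
      (∀ y : X, y ∉ (D : Set X) → stalkIdeal (controlledTransform (𝟙 X) (vanishingIdeal D) I m) y = stalkIdeal I y) ∧
      I ≤ controlledTransform (𝟙 X) (vanishingIdeal D) I m := by
  have hπ : IsBlowup (𝟙 X) (vanishingIdeal D) := IsBlowup.id hcart
  have hstalk : ∀ y : X, stalkIdeal (controlledTransform (𝟙 X) (vanishingIdeal D) I m) y =
      Submodule.colon (stalkIdeal I y) ((stalkIdeal (vanishingIdeal D) y ^ m : Ideal _) : Set _) := by
    intro y
    rw [hπ.stalkIdeal_controlledTransform I m y, comap_id, comap_id]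
  refine ⟨IsPermissibleBlowupSeq.single D (𝟙 X) hreg hD hπ, hstalk, ?_, ?_⟩
  · intro y hy
    rw [hstalk y, stalkIdeal_vanishingIdeal_of_not_mem D hy, Ideal.top_pow]
    exact colon_top_set _
  · have h := comap_le_controlledTransform (𝟙 X) (vanishingIdeal D) I m
    rwa [comap_id] at h

/-- **The ladder's induction step for a regular Cartier centre** (no new scheme): if the colon ideal `(I : 𝓘_D^m)` is
order-reducible for `m`, so is `I`. [folklore] -/
theorem orderReducible_of_cartierCentre_step (D : Closeds X) (hreg : Scheme.IsRegular (vanishingIdeal D).subscheme)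
    (hcart : IsEffectiveCartier (vanishingIdeal D)) {I : X.IdealSheafData} {m : ℕ}
    (hD : ∀ y ∈ (D : Set X), (m : ℕ∞) ≤ idealOrder I y)
    (h : OrderReducible (controlledTransform (𝟙 X) (vanishingIdeal D) I m) m) : OrderReducible I m :=
  OrderReducible.of_isPermissibleBlowupSeq (step_of_cartierCentre D hreg hcart hD).1 h

end CampaignW46

end Summit.ResolutionOfSingularities.ResolutionOfSingularities.Theorems

end
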